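import Summits.ResolutionOfSingularities.ResolutionOfSingularities.Theorems.RadicialJungCleanModelsF75cPrincipalization
import HarnessLib

/-!
# Crux `NoZenoR` (stmt-ResolutionOfSingularities-19943) — toward the W3 print `Lipman1969_1_2_B`:
# principalization of an ideal sheaf on an integral regular surface by point blow-ups, WITHOUT excellence

Route `ResolutionOfSingularities/HomologicalConductor` (cell decomp-res, hand leafhand-res-homologicalconduct-18 g0).
OURS: AI-written bookkeeping over tree theorems, weaker than expert review; nothing here is a statement of the
manuscript under review (Hironaka 2017).  SUPPORT level, counted 0.  Def-free, fact-free.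

The tree's brick P3 `F75c.exists_isPointBlowupComposition_isLocallyPrincipal` (Stacks Tag 0AHH via
Zariski–Samuel II App. 5: the base tree of an ideal in a two-dimensional regular local ring is finite,
`finite_idealBaseTree_of_isRegularLocalRing`, and one point blow-up lowers the total count,
`F75c.measure_comap_lt`) carries an EXCELLENCE binder which its proof only threads through the invariants
(`IsBlowup.isExcellent`) and never consumes.  Lipman's statement B) concerns a desingularization `X → Spec R`
of an ARBITRARY two-dimensional normal Noetherian local domain `R` — `X` need not be excellent — so we re-run
brick P3 verbatim without that binder:

* `IsPointBlowupComposition.invariants_noexc` — Noetherian, regular, `dim ≤ 2` persist along a composition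
  of point blow-ups (no excellence);
* `exists_isPointBlowupComposition_isLocallyPrincipal_noexc` — for `X` integral Noetherian regular of
  dimension `≤ 2` and an ideal sheaf `I`, a composition `π : X' → X` of blowing ups at closed points over the
  non-locally-principal locus of `I` with `I·𝒪_{X'}` locally principal.

No crux or summit statement is proved here.
-/

noncomputable section

-- single-problem summit: the doubled namespace component `ResolutionOfSingularities` is forced
set_option linter.dupNamespace false

open CategoryTheory AlgebraicGeometry TopologicalSpace IsLocalRing
open Literature.AlgebraicGeometry.Resolution
open Summit.ResolutionOfSingularities.ResolutionOfSingularities.Theorems.CampaignW46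
open Summit.ResolutionOfSingularities.ResolutionOfSingularities.Theorems.F75c
open Scheme.IdealSheafData

universe u

namespace Summit.ResolutionOfSingularities.ResolutionOfSingularities.Theorems.NoZeno.Lipman12B

/-- **Noetherian, regular and `dim ≤ 2` persist along a composition of blowing ups at closed points** — the
excellence-free part of `F75c.IsPointBlowupComposition.invariants` (a blowing up of a regular locally
Noetherian scheme along a regular centre is regular; blow-ups do not raise the dimension).
[cite: Liu2002, Thm. 8.1.19]; [cite: StacksProject, Tag 0BIC (Lemma 54.15.6, proof ¶1)] -/
theorem IsPointBlowupComposition.invariants_noexc {X : Scheme.{u}} [IsNoetherian X] {T : Set X} :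
    ∀ {X' : Scheme.{u}} {π : X' ⟶ X}, IsPointBlowupComposition T π →
      Scheme.IsRegular X → topologicalKrullDim X ≤ 2 →
      IsNoetherian X' ∧ Scheme.IsRegular X' ∧ topologicalKrullDim X' ≤ 2 := by
  intro X' π h
  induction h with
  | nil => exact fun hr hd => ⟨inferInstance, hr, hd⟩
  | cons τ σ x' hx' hσ hne hT hτ ih =>
    intro hr hd
    obtain ⟨hN, hr', hd'⟩ := ih hr hd
    haveI := hN
    haveI : IsProper τ := hτ.isProper
    haveI : IsLocallyNoetherian _ := LocallyOfFiniteType.isLocallyNoetherian τ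
    haveI : CompactSpace _ := QuasiCompact.compactSpace_of_compactSpace τ
    refine ⟨{}, ?_, ?_⟩
    · exact hτ.isRegular_of_isRegular_subscheme hr' (isRegular_subscheme_vanishingIdeal_singleton hx')
    · have h2 : topologicalKrullDim _ ≤ ((2 : ℕ) : WithBot ℕ∞) :=
        hτ.topologicalKrullDim_le_of_isLocallyNoetherian (n := 2) (by exact_mod_cast hd')
      exact_mod_cast h2

/-- **Principalization of an ideal sheaf on an integral regular surface by blowing up closed points, without
excellence** (Stacks Tag 0AHH / 0BIB, integral case, located form): for `X` integral, Noetherian, regular of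
dimension `≤ 2` and an ideal sheaf `I` there is a composition `π : X' → X` of blowing ups at closed points,
each lying over the non-locally-principal locus of `I`, with `I·𝒪_{X'}` locally principal.  Proof = brick P3
verbatim (induction on `Σ_{x ∈ NP(I)} #idealBaseTree R_x J_x`, Zariski–Samuel II App. 5, dropping under one
point blow-up by `F75c.measure_comap_lt`) with `invariants_noexc` in place of `invariants`.
[cite: StacksProject, Tag 0AHH (Lemma 54.4.1)]; [cite: ZariskiSamuel1960, Appendix 5] -/
theorem exists_isPointBlowupComposition_isLocallyPrincipal_noexc (X : Scheme.{u}) [IsIntegral X]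
    [IsNoetherian X] (hreg : Scheme.IsRegular X) (hdim : topologicalKrullDim X ≤ 2)
    (I : X.IdealSheafData) :
    ∃ (X' : Scheme.{u}) (π : X' ⟶ X), IsPointBlowupComposition (nonPrincipalLocus I : Set X) π ∧
      IsLocallyPrincipal (I.comap π) := by
  classical
  -- the measure
  let N : ∀ (Y : Scheme.{u}) [IsIntegral Y] (J : Y.IdealSheafData),
      (nonPrincipalLocus J : Set Y).Finite → ℕ :=
    fun Y _ J hN => ∑ y ∈ hN.toFinset, (idealBaseTree (algebraMap (Y.presheaf.stalk y) Y.functionField).range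
      ((stalkIdeal J y).map (algebraMap (Y.presheaf.stalk y) Y.functionField).rangeRestrict)).ncard
  suffices H : ∀ (n : ℕ) (Y : Scheme.{u}) [IsIntegral Y] [IsNoetherian Y], Scheme.IsRegular Y →
      topologicalKrullDim Y ≤ 2 → ∀ (J : Y.IdealSheafData)
      (hN : (nonPrincipalLocus J : Set Y).Finite), N Y J hN ≤ n →
      ∃ (Y' : Scheme.{u}) (π : Y' ⟶ Y), IsPointBlowupComposition (nonPrincipalLocus J : Set Y) π ∧
        IsLocallyPrincipal (J.comap π) from
    H _ X hreg hdim I (finite_nonPrincipalLocus hreg hdim I).1 le_rfl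
  intro n
  induction n with
  | zero =>
    intro Y _ _ hreg hdim J hN hle
    -- measure `0`: every local count is `≥ 1` on the locus, so the locus is empty
    have hempty : (nonPrincipalLocus J : Set Y) = ∅ := by
      by_contra hne
      obtain ⟨y, hy⟩ := Set.nonempty_iff_ne_empty.mpr hne
      have hy2 := ((finite_nonPrincipalLocus hreg hdim J).2 y hy).2
      haveI := hreg y
      haveI := isLocalRing_range_algebraMap_stalk (Z := Y) y
      haveI : IsRegularLocalRing (algebraMap (Y.presheaf.stalk y) Y.functionField).range :=
        isRegularLocalRing_range_of y
      have hR2 : ringKrullDim (algebraMap (Y.presheaf.stalk y) Y.functionField).range = 2 := by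
        rw [ringKrullDim_range_algebraMap_stalk]; exact hy2
      have hyJ : ¬ (stalkIdeal J y).IsPrincipal := by
        have h := hy
        rw [coe_nonPrincipalLocus_eq_setOf_not_isPrincipal] at h
        exact h
      have h1 := one_le_ncard_idealBaseTree
        (fun h => hyJ ((isPrincipal_stalkIdeal_iff J y).mp h))
        (finite_idealBaseTree_of_isRegularLocalRing _ hR2 (isLocalRingOf_range_algebraMap_stalk y) _)
      have hyN : y ∈ hN.toFinset := by rw [Set.Finite.mem_toFinset]; exact hy
      have := Finset.single_le_sum (f := fun z => (idealBaseTree (algebraMap (Y.presheaf.stalk z) Y.functionField).range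
        ((stalkIdeal J z).map (algebraMap (Y.presheaf.stalk z) Y.functionField).rangeRestrict)).ncard)
        (fun z _ => Nat.zero_le _) hyN
      change _ ≤ N Y J hN at this
      omega
    refine ⟨Y, 𝟙 Y, IsPointBlowupComposition.nil, ?_⟩
    rw [Scheme.IdealSheafData.comap_id]
    exact (nonPrincipalLocus_eq_bot_iff J).mp (by
      apply Closeds.ext; rw [hempty]; rfl)
  | succ n ih =>
    intro Y _ _ hreg hdim J hN hle
    by_cases hempty : (nonPrincipalLocus J : Set Y) = ∅
    · refine ⟨Y, 𝟙 Y, IsPointBlowupComposition.nil, ?_⟩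
      rw [Scheme.IdealSheafData.comap_id]
      exact (nonPrincipalLocus_eq_bot_iff J).mp (by
        apply Closeds.ext; rw [hempty]; rfl)
    -- a non-principal point `y`: closed, with two-dimensional regular local ring
    obtain ⟨y, hy⟩ := Set.nonempty_iff_ne_empty.mpr hempty
    obtain ⟨hyc, hy2⟩ := (finite_nonPrincipalLocus hreg hdim J).2 y hy
    haveI := hreg y
    have hyne : ({y} : Set Y) ≠ Set.univ := by
      intro h
      have hJ0 : J ≠ ⊥ := by
        rintro rfl
        have h' := hy
        rw [coe_nonPrincipalLocus_eq_setOf_not_isPrincipal, Set.mem_setOf_eq] at h'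
        apply h'
        rw [stalkIdeal_bot]
        exact ⟨⟨0, by simp⟩⟩
      have hη : genericPoint Y ∈ ({y} : Set Y) := h ▸ Set.mem_univ _
      rw [Set.mem_singleton_iff] at hη
      exact genericPoint_not_mem_nonPrincipalLocus hJ0 (hη ▸ hy)
    -- blow up `y`
    obtain ⟨Y₁, π₁, hπ₁⟩ := exists_isBlowup Y (vanishingIdeal ⟨{y}, hyc⟩)
    haveI : IsIntegral Y₁ := hπ₁.isIntegral (vanishingIdeal_singleton_ne_bot hyc hyne)
    have h₁ : IsPointBlowupComposition (nonPrincipalLocus J : Set Y) π₁ :=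
      IsPointBlowupComposition.single π₁ y hyc hyne hy hπ₁
    obtain ⟨hN₁, hreg₁, hdim₁⟩ := IsPointBlowupComposition.invariants_noexc h₁ hreg hdim
    haveI := hN₁
    have hfin₁ := (finite_nonPrincipalLocus hreg₁ hdim₁ (J.comap π₁)).1
    -- the measure drops
    have hlt : N Y₁ (J.comap π₁) hfin₁ < N Y J hN := measure_comap_lt hyc hπ₁ hy2 J hy hN hfin₁
    obtain ⟨Y', π', hπ', hlp⟩ := ih Y₁ hreg₁ hdim₁ (J.comap π₁) hfin₁ (by omega)
    refine ⟨Y', π' ≫ π₁, h₁.comp ?_ hπ', by rwa [Scheme.IdealSheafData.comap_comp]⟩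
    rintro _ ⟨y', hy', rfl⟩
    exact nonPrincipalLocus_comap_subset π₁ J hy'

end Summit.ResolutionOfSingularities.ResolutionOfSingularities.Theorems.NoZeno.Lipman12B

end
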